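import Literature.NumberTheory.EllipticCurves.HasseWeilAbelianEulerFactorTorsion
import Literature.NumberTheory.GaloisRepresentations.CyclotomicCharacterReductionProofs
import HarnessLib

/-!
# The torsion-point forms of Serre–Tate's Lemma 2 at the multiplicative places, from an
# equivariant reduction datum onto the units of the residue field `\bar ℤ_K/𝔓`

Topic `NumberTheory/EllipticCurves`; *proofs* file (theorems only) below the two named facts of
`HasseWeilAbelianEulerFactorTorsion`,
`WeierstrassCurve.serreTate_smul_torsion_of_hasSplitMultiplicativeReductionAt` (at a split
multiplicative place `v ∤ ℓ`, `𝔓 ∣ v`: `σ(cP) = (χ_ℓ(σ) mod ℓⁿ)(cP)` for `σ ∈ D_𝔓` and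
`I_𝔓`-fixed `P ∈ E(K̄)[ℓⁿ]`) and
`WeierstrassCurve.serreTate_frobenius_smul_torsion_of_hasNonsplitMultiplicativeReductionAt`
(non-split: `σ(cP) = -(N v)(cP)` for an arithmetic Frobenius `σ`), in the style of
`TateModuleInertiaReductionProofs` (which does the same for the dimension facts): the
**geometric input of the printed proof is isolated as an explicit, elementary datum** and
everything downstream of it is proved.

The printed proof (Serre–Tate, *Good reduction of abelian varieties* (1968), §1, Lemma 2,
p. 495: *"The reduction map `O_L → k̄` defines a homomorphism `r : A(L) = A_v(O_L) → Ã(k̄)` …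
the kernel of `r` is uniquely divisible by `m`.  Hence `r` defines [an isomorphism]
`A_m^I → Ã_m`; this isomorphism commutes with the action of `D(v̄)` by transport de
structure"*; for elliptic curves Silverman, *ATAEC*, proof of Thm. IV.10.2(a), PDF p. 359, and
*AEC* VII.2.1, VII.3.1, VII.6.1) provides, with `L = K̄^{I_𝔓}`:
a subgroup `A' = E₀(L)` of `E(K̄)`, stable under `D_𝔓`, with `c • E(K̄)^{I_𝔓} ⊆ A'`
(`c = (E(L) : E₀(L))`, Kodaira–Néron), and the reduction homomorphism onto the non-singular
points of the reduced minimal model composed with the node parametrisation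
`ψ = (y - α₁x - β₁)/(y - α₂x - β₂)` (Silverman, *AEC*, III.2.5), `r : A' → k̄ˣ`,
`k̄ = \bar ℤ_K/𝔓`, whose kernel `E₁(L)` has no `ℓ`-torsion, and which is `D_𝔓`-equivariant at
a split node (`ψ` has coefficients in `k_v`) and anti-equivariant for the Frobenius at a
non-split node (the Frobenius swaps the two tangent lines: `ψ(σ̄ P̃) = σ̄(ψ P̃)⁻¹`,
*AEC* Exercise 3.5(a)(ii)).  Given such a datum — for an arbitrary `Γ_K`-module `A` in place
of `E(K̄)` — this file proves the conclusions of the two named facts: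

* `eq_zero_of_map_eq_zero_of_pow_smul_eq_zero`, `eq_of_map_eq_of_pow_smul_eq_zero`: a
  homomorphism with `ℓ`-torsion-free kernel has `ℓ`-power-torsion-free kernel, hence detects
  identities between `ℓ`-power torsion points ("`r` is injective on `A'[ℓ^∞]`");
* `exists_pow_eq_one_map_mk_eq`: every `ℓⁿ`-th root of unity of a domain `k'` receiving
  `\bar ℤ_K/𝔓` (`𝔓 ∌ ℓ`) injectively along `φ` is `φ(μ̄)` for an `ℓⁿ`-th root of unity
  `μ ∈ \bar ℤ_K` (the `ℓⁿ` roots of unity of `\bar ℤ_K` stay distinct modulo `𝔓`,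
  `IsPrimitiveRoot.pow_eq_pow_of_sub_mem` of `ModNCyclotomicCharacter`, and a domain has at most
  `ℓⁿ` of them) — so the residue field may be `\bar ℤ_K/𝔓` itself or the residue field of a
  completion `K̄_v` matched with `𝔓` (the setting of `InertiaInvariantsKodairaNeronAdditiveProofs`);
* `smul_nsmul_eq_cyclotomicCharacter_smul_of_reduction` (**split shape**): from a
  `σ`-equivariant datum `(A', c, r)` onto `k'ˣ` (`σ ∈ Γ_K`, one at a time),
  `σ(c • P) = (χ_ℓ(σ) mod ℓⁿ) • (c • P)` for all `I_𝔓`-fixed `P ∈ A[ℓⁿ]`; the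
  Galois-side input is that `Γ_K` acts on `μ_{ℓⁿ}(\bar ℤ_K)` through `χ_ℓ mod ℓⁿ`
  (`absIntegers.smul_eq_pow_cyclotomicCharacter_of_pow_eq_one`,
  `GaloisRepresentations/CyclotomicCharacterReductionProofs`);
* `smul_nsmul_eq_residueCard_smul_of_reduction` (**split shape, Frobenius only**): from a datum
  equivariant for an arithmetic Frobenius `σ` at `𝔓 ∣ v ∤ ℓ`, `σ(c • P) = N v • (c • P)` (the
  input of the Frobenius-only route, `HasseWeilAbelianEulerFactorFrobenius`);
* `smul_nsmul_eq_neg_residueCard_smul_of_reduction` (**non-split shape**): from a datum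
  anti-equivariant for an arithmetic Frobenius `σ` at `𝔓 ∣ v ∤ ℓ`,
  `σ(c • P) = -(N v • (c • P))`; the Galois-side input is `\overline{σ x} = x̄^{N v}` (Mathlib
  `AlgHom.IsArithFrobAt.mk_apply`, `HeightOneSpectrum.card_quotient_under_eq_residueCard`).

What remains for the two named facts is thus exactly the construction of the datum
`(E₀(K̄^{I_𝔓}), c, ψ ∘ reduction)` at a multiplicative place with these properties (reduction
homomorphism and its kernel: `ReductionHomomorphism`, `GoodReductionInertia`; finiteness of
`E(K^nr)/E₀(K^nr)`: `KodairaNeronUnramified`; node parametrisation: `SingularCubic`,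
`NonsplitNode`); no Tate-module, representation or cyclotomic theory is left.

## References

* J.-P. Serre, J. Tate, *Good reduction of abelian varieties*, Ann. of Math. (2) 88 (1968),
  §1 Lemma 1, Lemma 2 (p. 495). [SerreTate1968]
* J. H. Silverman, *The Arithmetic of Elliptic Curves*, 2nd ed., GTM 106 (2009): Prop. III.2.5
  (PDF p. 59), Exercise 3.5 (PDF p. 97), Props. VII.2.1, VII.3.1, Thm. VII.6.1 (PDF p. 177).
  [SilvermanAEC2009]
* J. H. Silverman, *Advanced Topics in the Arithmetic of Elliptic Curves*, GTM 151 (1994): proof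
  of Thm. IV.10.2(a) (PDF p. 359). [SilvermanATAEC1994]

## Design

`noncomputable section`, universes `u` (`K`), `v` (the module `A`), `w` (the residue domain
`k'`); the datum is phrased exactly as in `TateModuleInertiaReductionProofs`
(`A' : AddSubgroup A`, `c • _ ∈ A'`, `r : A' →+ Additive k'ˣ`, kernel condition
`r P = 0 → ℓ • P = 0 → P = 0`), the residue domain `k'` receiving
`absIntegers (𝓞 K) K ⧸ 𝔓` along an injective `φ`, so that the (anti-)equivariance can be stated
through lifts (`φ (Ideal.Quotient.mk 𝔓 x) = r P → r (σ P) = φ (Ideal.Quotient.mk 𝔓 (σ • x))`,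
resp. `r (σ P) * φ (Ideal.Quotient.mk 𝔓 (σ • x)) = 1`), without naming the induced automorphism
of the residue field.  Theorems only.
-/

noncomputable section

open scoped NumberField
open Field IsDedekindDomain

universe u v w

namespace Literature.NumberTheory.EllipticCurves

open Literature.NumberTheory.GaloisRepresentations

/-! ### A reduction map with `ℓ`-torsion-free kernel detects the action on `ℓ`-power torsion -/

section Kernel

variable {A : Type u} [AddCommGroup A] {B : Type v} [AddCommGroup B]

/-- If the kernel of `r : A' →+ B` has no `ℓ`-torsion, it has no `ℓ`-power torsion. [folklore] -/
theorem eq_zero_of_map_eq_zero_of_pow_smul_eq_zero {A' : AddSubgroup A} (r : A' →+ B) {ℓ : ℕ}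
    (hker : ∀ P : A', r P = 0 → ℓ • P = 0 → P = 0) :
    ∀ (n : ℕ) (P : A'), r P = 0 → ℓ ^ n • P = 0 → P = 0 := by
  intro n
  induction n with
  | zero => intro P _ hP; simpa using hP
  | succ n ih =>
    intro P hr hP
    have h1 : ℓ ^ n • P = 0 := by
      refine hker (ℓ ^ n • P) (by rw [map_nsmul, hr, smul_zero]) ?_
      rw [← mul_smul, ← pow_succ', hP]
    exact ih P hr h1

/-- **A reduction map with `ℓ`-torsion-free kernel detects identities between `ℓ`-power torsion
points**: if `r P = r Q` with `ℓⁿ P = ℓⁿ Q = 0`, then `P = Q`. [folklore] -/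
theorem eq_of_map_eq_of_pow_smul_eq_zero {A' : AddSubgroup A} (r : A' →+ B) {ℓ : ℕ}
    (hker : ∀ P : A', r P = 0 → ℓ • P = 0 → P = 0) {n : ℕ} {P Q : A'} (hPQ : r P = r Q)
    (hP : ℓ ^ n • P = 0) (hQ : ℓ ^ n • Q = 0) : P = Q := by
  refine sub_eq_zero.mp (eq_zero_of_map_eq_zero_of_pow_smul_eq_zero r hker n (P - Q) ?_ ?_)
  · rw [map_sub, hPQ, sub_self]
  · rw [smul_sub, hP, hQ, sub_self]

end Kernel

/-! ### Roots of unity of a residue field come from `\bar ℤ_K` -/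

section Lift

variable {K : Type u} [Field K] [NumberField K] (ℓ : ℕ) [Fact ℓ.Prime]
variable {k' : Type w} [CommRing k'] [IsDomain k']

/-- **Every `ℓⁿ`-th root of unity of a domain `k'` receiving `\bar ℤ_K/𝔓` (`𝔓 ∌ ℓ`)
injectively is the image of an `ℓⁿ`-th root of unity of `\bar ℤ_K`**: the `ℓⁿ` roots of unity
`ζ^i` of `\bar ℤ_K` (`exists_isPrimitiveRoot_absIntegers`) stay distinct modulo `𝔓`
(`IsPrimitiveRoot.pow_eq_pow_of_sub_mem`, `ModNCyclotomicCharacter`), so their images exhaust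
the at most `ℓⁿ` roots of `X^{ℓⁿ} - 1` in `k'` (`Polynomial.card_nthRoots`).  (For
`k' = \bar ℤ_K/𝔓` itself, or the residue field of a completion of `K̄` at `𝔓`.) [folklore] -/
theorem exists_pow_eq_one_map_mk_eq {𝔓 : Ideal (absIntegers (𝓞 K) K)} [𝔓.IsPrime]
    (hℓ : (ℓ : absIntegers (𝓞 K) K) ∉ 𝔓) (φ : absIntegers (𝓞 K) K ⧸ 𝔓 →+* k')
    (hφ : Function.Injective φ) (n : ℕ) {u : k'} (hu : u ^ ℓ ^ n = 1) :
    ∃ μ : absIntegers (𝓞 K) K, μ ^ ℓ ^ n = 1 ∧ φ (Ideal.Quotient.mk 𝔓 μ) = u := by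
  classical
  haveI : NeZero (ℓ ^ n) := ⟨pow_ne_zero n (Fact.out : ℓ.Prime).ne_zero⟩
  have hN : 0 < ℓ ^ n := pow_pos (Fact.out : ℓ.Prime).pos n
  have hℓn : ((ℓ ^ n : ℕ) : absIntegers (𝓞 K) K) ∉ 𝔓 := by
    rw [Nat.cast_pow]
    exact fun hmem ↦ hℓ (Ideal.IsPrime.mem_of_pow_mem inferInstance n hmem)
  obtain ⟨ζ, hζ⟩ := exists_isPrimitiveRoot_absIntegers K (ℓ ^ n)
  -- the images of the `ζ ^ i`, `i < ℓⁿ`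
  set f : ℕ → k' := fun i ↦ φ (Ideal.Quotient.mk 𝔓 (ζ ^ i)) with hf
  have hfinj : Set.InjOn f (Finset.range (ℓ ^ n) : Set ℕ) := by
    intro i hi j hj hij
    have hij' : Ideal.Quotient.mk 𝔓 (ζ ^ i) = Ideal.Quotient.mk 𝔓 (ζ ^ j) := hφ hij
    have := hζ.pow_eq_pow_of_sub_mem hℓn (Ideal.Quotient.eq.mp hij')
    exact hζ.pow_inj (Finset.mem_range.mp hi) (Finset.mem_range.mp hj) this
  set S : Finset k' := (Finset.range (ℓ ^ n)).image f with hS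
  have hScard : S.card = ℓ ^ n := by
    rw [hS, Finset.card_image_of_injOn hfinj, Finset.card_range]
  have hSsub : S ⊆ Polynomial.nthRootsFinset (ℓ ^ n) (1 : k') := by
    intro y hy
    rw [hS, Finset.mem_image] at hy
    obtain ⟨i, -, rfl⟩ := hy
    rw [Polynomial.mem_nthRootsFinset hN, hf]
    simp only
    rw [← map_pow, ← map_pow, ← pow_mul, mul_comm, pow_mul, hζ.pow_eq_one, one_pow, map_one,
      map_one]
  have hTcard : (Polynomial.nthRootsFinset (ℓ ^ n) (1 : k')).card ≤ S.card := by
    rw [hScard, Polynomial.nthRootsFinset_def]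
    exact (Multiset.toFinset_card_le _).trans (Polynomial.card_nthRoots _ _)
  have hST := Finset.eq_of_subset_of_card_le hSsub hTcard
  have huT : u ∈ Polynomial.nthRootsFinset (ℓ ^ n) (1 : k') :=
    (Polynomial.mem_nthRootsFinset hN 1).mpr hu
  rw [← hST, hS, Finset.mem_image] at huT
  obtain ⟨i, -, hi⟩ := huT
  refine ⟨ζ ^ i, ?_, hi⟩
  rw [← pow_mul, mul_comm, pow_mul, hζ.pow_eq_one, one_pow]

end Lift

/-! ### Equivariant reduction data onto the units of a residue field -/

section Reduction

variable {K : Type u} [Field K] [NumberField K]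
variable {A : Type v} [AddCommGroup A] [DistribMulAction (absoluteGaloisGroup K) A]
variable {k' : Type w} [CommRing k'] [IsDomain k']

/-- **The split shape.**  Let `𝔓 ∌ ℓ` be a prime of `\bar ℤ_K`, `k'` a domain receiving the
residue field `\bar ℤ_K/𝔓` injectively along `φ` (e.g. `\bar ℤ_K/𝔓` itself, or the residue
field of `K̄_v` at a prime matched with `𝔓`), `σ ∈ Γ_K` (in practice `σ ∈ D_𝔓`), `A` a
`Γ_K`-module, `A' ≤ A` a `σ`-stable subgroup containing `c • P` for every `I_𝔓`-fixed `P`, and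
`r : A' → k'ˣ` a homomorphism whose kernel has no `ℓ`-torsion and which is `σ`-equivariant in
the sense that `r(σ P) = φ(\overline{σ x})` whenever `φ(x̄) = r(P)`, `x ∈ \bar ℤ_K`.  Then for
every `I_𝔓`-fixed `P ∈ A[ℓⁿ]`: `σ(c • P) = (χ_ℓ(σ) mod ℓⁿ) • (c • P)` — the conclusion of
`WeierstrassCurve.serreTate_smul_torsion_of_hasSplitMultiplicativeReductionAt` at `𝔓`, `σ` (one
`σ ∈ D_𝔓` at a time, so that `σ` may be taken in the image of a local Galois group).  (For `A = E(K̄)`: `A' = E₀(K̄^{I_𝔓})`, `c = (E(K^nr) : E₀(K^nr))`,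
`r = ψ ∘ (reduction)` with `ψ : Ẽ_ns(k̄) ≅ k̄ˣ` the split node map, kernel `E₁` — Serre–Tate §1
Lemmas 1–2, Silverman *AEC* III.2.5, VII.2.1, VII.3.1, VII.6.1.)  Galois-side inputs: the
reduction `r(c • P)` of an `ℓⁿ`-torsion point is an `ℓⁿ`-th root of unity of `k'`, hence
`φ(μ̄)` for an `ℓⁿ`-th root of unity `μ ∈ \bar ℤ_K` (`exists_pow_eq_one_map_mk_eq`), on which `σ`
acts by `χ_ℓ(σ) mod ℓⁿ` (`absIntegers.smul_eq_pow_cyclotomicCharacter_of_pow_eq_one`,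
`GaloisRepresentations/CyclotomicCharacterReductionProofs`).
[cite: SerreTate1968, §1 Lemma 1 and Lemma 2 (p. 495)] -/
theorem smul_nsmul_eq_cyclotomicCharacter_smul_of_reduction (ℓ : ℕ) [Fact ℓ.Prime]
    {𝔓 : Ideal (absIntegers (𝓞 K) K)} [𝔓.IsPrime] (hℓ : (ℓ : absIntegers (𝓞 K) K) ∉ 𝔓)
    (φ : absIntegers (𝓞 K) K ⧸ 𝔓 →+* k') (hφ : Function.Injective φ) {σ : absoluteGaloisGroup K}
    (A' : AddSubgroup A) (hA'σ : ∀ P : A, P ∈ A' → σ • P ∈ A')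
    {c : ℕ} (hcA' : ∀ P : A, (∀ τ ∈ 𝔓.inertia (absoluteGaloisGroup K), τ • P = P) → c • P ∈ A')
    (r : A' →+ Additive k'ˣ)
    (hr : ∀ (P : A') (x : absIntegers (𝓞 K) K), φ (Ideal.Quotient.mk 𝔓 x) = ((r P).toMul : k') →
      ((r ⟨σ • (P : A), hA'σ P P.2⟩).toMul : k') = φ (Ideal.Quotient.mk 𝔓 (σ • x)))
    (hker : ∀ P : A', r P = 0 → ℓ • P = 0 → P = 0)
    (n : ℕ) (P : A) (hP : ∀ τ ∈ 𝔓.inertia (absoluteGaloisGroup K), τ • P = P)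
    (hPn : ℓ ^ n • P = 0) :
    σ • (c • P) =
      (((GaloisRep.cyclotomicCharacter K ℓ σ : ℤ_[ℓ]ˣ) : ℤ_[ℓ]).toZModPow n).val • (c • P) := by
  set m := (((GaloisRep.cyclotomicCharacter K ℓ σ : ℤ_[ℓ]ˣ) : ℤ_[ℓ]).toZModPow n).val
  set Q : A' := ⟨c • P, hcA' P hP⟩
  have hQn : ℓ ^ n • Q = 0 := Subtype.ext (by
    change ℓ ^ n • (c • P) = 0
    rw [smul_comm, hPn, smul_zero])
  have hQA : ℓ ^ n • (Q : A) = 0 := by simpa using congrArg Subtype.val hQn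
  -- the reduction `u` of `Q` is an `ℓⁿ`-th root of unity of `k'`, lift it to `μ ∈ \bar ℤ_K`
  set u : k'ˣ := (r Q).toMul with hu
  have hun : (u : k') ^ ℓ ^ n = 1 := by
    have h := congrArg Additive.toMul (map_nsmul r (ℓ ^ n) Q)
    rw [hQn, map_zero, toMul_zero, toMul_nsmul] at h
    rw [← Units.val_pow_eq_pow_val, ← h, Units.val_one]
  obtain ⟨μ, hμ, hμu⟩ := exists_pow_eq_one_map_mk_eq ℓ hℓ φ hφ n hun
  -- `r (σ Q) = φ(σ μ) = φ(μ ^ m) = u ^ m = r (m • Q)`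
  have hσQ : r ⟨σ • (Q : A), hA'σ Q Q.2⟩ = r (m • Q) := by
    apply Additive.toMul.injective
    apply Units.ext
    rw [hr Q μ hμu, absIntegers.smul_eq_pow_cyclotomicCharacter_of_pow_eq_one ℓ n _ hμ,
      map_pow, map_pow, hμu, map_nsmul, toMul_nsmul, Units.val_pow_eq_pow_val]
  have hP' : ℓ ^ n • (⟨σ • (Q : A), hA'σ Q Q.2⟩ : A') = 0 :=
    Subtype.ext (by simp [smul_comm (ℓ ^ n) σ (Q : A), hQA])
  have hQ' : ℓ ^ n • (m • Q) = 0 := by rw [smul_comm, hQn, smul_zero]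
  have key : (⟨σ • (Q : A), hA'σ Q Q.2⟩ : A') = m • Q :=
    eq_of_map_eq_of_pow_smul_eq_zero (A' := A') (B := Additive k'ˣ) r hker hσQ hP' hQ'
  simpa using congrArg Subtype.val key

/-- **The non-split shape.**  Let `𝔓 ∣ v ∤ ℓ` be a prime of `\bar ℤ_K` above the finite place
`v`, `k'` a domain receiving `\bar ℤ_K/𝔓` injectively along `φ`, `σ ∈ Γ_K` an arithmetic
Frobenius at `𝔓` (`σ x ≡ x^{N v} mod 𝔓`), `A` a `Γ_K`-module, `A' ≤ A` a `σ`-stable subgroup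
containing `c • P` for every `I_𝔓`-fixed `P`, and `r : A' → k'ˣ` a homomorphism whose kernel
has no `ℓ`-torsion and which is **anti**-equivariant for `σ`: `r(σ P) · φ(\overline{σ x}) = 1`
whenever `φ(x̄) = r(P)` (for `A = E(K̄)` at a non-split node: `r = ψ ∘ (reduction)` with
`ψ = (y - α₁x - β₁)/(y - α₂x - β₂)`, and the Frobenius swaps the two tangent lines,
`ψ(σ̄ P̃) = σ̄(ψ P̃)⁻¹`, Silverman *AEC* III.2.5, Exercise 3.5(a)(ii)).  Then for every
`I_𝔓`-fixed `P ∈ A[ℓⁿ]`: `σ(c • P) = -(N v • (c • P))` — the conclusion of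
`WeierstrassCurve.serreTate_frobenius_smul_torsion_of_hasNonsplitMultiplicativeReductionAt` at
`𝔓`, `σ`.  Galois-side inputs: the lift of `r(c • P)` to a root of unity `μ ∈ \bar ℤ_K`
(`exists_pow_eq_one_map_mk_eq`) and `\overline{σ μ} = μ̄^{N v}` (Mathlib
`AlgHom.IsArithFrobAt.mk_apply`, `HeightOneSpectrum.card_quotient_under_eq_residueCard`).
[cite: SerreTate1968, §1 Lemma 1 and Lemma 2 (p. 495)]
[cite: SilvermanAEC2009, Prop. III.2.5(a) and Exercise 3.5(a)(ii) (PDF pp. 59, 97)] -/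
theorem smul_nsmul_eq_neg_residueCard_smul_of_reduction (ℓ : ℕ) [Fact ℓ.Prime]
    {v : HeightOneSpectrum (𝓞 K)} (hℓv : (ℓ : 𝓞 K) ∉ v.asIdeal)
    {𝔓 : Ideal (absIntegers (𝓞 K) K)} (h𝔓 : 𝔓 ∈ v.primesAbove)
    (φ : absIntegers (𝓞 K) K ⧸ 𝔓 →+* k') (hφ : Function.Injective φ)
    {σ : absoluteGaloisGroup K} (hσ : IsArithFrobAt (𝓞 K) σ 𝔓) (A' : AddSubgroup A)
    (hA'σ : ∀ P : A, P ∈ A' → σ • P ∈ A')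
    {c : ℕ} (hcA' : ∀ P : A, (∀ τ ∈ 𝔓.inertia (absoluteGaloisGroup K), τ • P = P) → c • P ∈ A')
    (r : A' →+ Additive k'ˣ)
    (hr : ∀ (P : A') (x : absIntegers (𝓞 K) K), φ (Ideal.Quotient.mk 𝔓 x) = ((r P).toMul : k') →
      ((r ⟨σ • (P : A), hA'σ P P.2⟩).toMul : k') * φ (Ideal.Quotient.mk 𝔓 (σ • x)) = 1)
    (hker : ∀ P : A', r P = 0 → ℓ • P = 0 → P = 0)
    (n : ℕ) (P : A) (hP : ∀ τ ∈ 𝔓.inertia (absoluteGaloisGroup K), τ • P = P)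
    (hPn : ℓ ^ n • P = 0) :
    σ • (c • P) = -(v.residueCard • (c • P)) := by
  haveI : 𝔓.IsPrime := h𝔓.1
  have hℓ : (ℓ : absIntegers (𝓞 K) K) ∉ 𝔓 := absIntegers.natCast_notMem_of_mem_primesAbove hℓv h𝔓
  set q := v.residueCard
  set Q : A' := ⟨c • P, hcA' P hP⟩
  have hQn : ℓ ^ n • Q = 0 := Subtype.ext (by
    change ℓ ^ n • (c • P) = 0
    rw [smul_comm, hPn, smul_zero])
  have hQA : ℓ ^ n • (Q : A) = 0 := by simpa using congrArg Subtype.val hQn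
  set u : k'ˣ := (r Q).toMul with hu
  have hun : (u : k') ^ ℓ ^ n = 1 := by
    have h := congrArg Additive.toMul (map_nsmul r (ℓ ^ n) Q)
    rw [hQn, map_zero, toMul_zero, toMul_nsmul] at h
    rw [← Units.val_pow_eq_pow_val, ← h, Units.val_one]
  obtain ⟨μ, -, hμu⟩ := exists_pow_eq_one_map_mk_eq ℓ hℓ φ hφ n hun
  -- `\overline{σ μ} = μ̄ ^ q`
  have hfrob : Ideal.Quotient.mk 𝔓 (σ • μ) = Ideal.Quotient.mk 𝔓 μ ^ q := by
    have h := hσ.mk_apply μ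
    rw [MulSemiringAction.toAlgHom_apply,
      HeightOneSpectrum.card_quotient_under_eq_residueCard h𝔓] at h
    exact h
  -- `r (σ Q) = (u ^ q)⁻¹ = r (-(q • Q))`
  have hσQ : r ⟨σ • (Q : A), hA'σ Q Q.2⟩ = r (-(q • Q)) := by
    apply Additive.toMul.injective
    rw [map_neg, map_nsmul, toMul_neg, toMul_nsmul, ← hu]
    apply eq_inv_of_mul_eq_one_left
    apply Units.ext
    have h1 := hr Q μ hμu
    rw [hfrob, map_pow, hμu] at h1
    rwa [Units.val_mul, Units.val_pow_eq_pow_val, Units.val_one]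
  have hP' : ℓ ^ n • (⟨σ • (Q : A), hA'σ Q Q.2⟩ : A') = 0 :=
    Subtype.ext (by simp [smul_comm (ℓ ^ n) σ (Q : A), hQA])
  have hQ' : ℓ ^ n • (-(q • Q)) = 0 := by rw [smul_neg, smul_comm, hQn, smul_zero, neg_zero]
  have key : (⟨σ • (Q : A), hA'σ Q Q.2⟩ : A') = -(q • Q) :=
    eq_of_map_eq_of_pow_smul_eq_zero (A' := A') (B := Additive k'ˣ) r hker hσQ hP' hQ'
  simpa using congrArg Subtype.val key

/-- **The split shape, Frobenius only.**  Same datum as in the non-split shape but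
**equivariant** for the arithmetic Frobenius `σ` at `𝔓 ∣ v ∤ ℓ` (`r(σ P) = φ(\overline{σ x})`
whenever `φ(x̄) = r(P)`; the split node, where `ψ` commutes with `σ̄`): then
`σ(c • P) = N v • (c • P)` for every `I_𝔓`-fixed `P ∈ A[ℓⁿ]` — Frobenius acts on
`Ẽ_ns(k̄)[ℓⁿ] = μ_{ℓⁿ}(k̄)` by `ζ ↦ ζ^{N v}` (Serre–Tate §1 Lemma 2; Serre, *Abelian `ℓ`-adic
representations*, I.1.2, `χ_ℓ(F_v) = N v`; Silverman *ATAEC* Exercise 5.13(a),(b)).  This is the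
input shape of the Frobenius-only route to the Euler factor at a split multiplicative place
(only arithmetic Frobenius elements of `D_𝔓` are needed by
`Literature.NumberTheory.EllipticCurves.hasseWeilEulerFactor`).
[cite: SerreTate1968, §1 Lemma 1 and Lemma 2 (p. 495)]
[cite: SilvermanATAEC1994, Exercise 5.13(a),(b) (PDF p. 416)] -/
theorem smul_nsmul_eq_residueCard_smul_of_reduction (ℓ : ℕ) [Fact ℓ.Prime]
    {v : HeightOneSpectrum (𝓞 K)} (hℓv : (ℓ : 𝓞 K) ∉ v.asIdeal)
    {𝔓 : Ideal (absIntegers (𝓞 K) K)} (h𝔓 : 𝔓 ∈ v.primesAbove)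
    (φ : absIntegers (𝓞 K) K ⧸ 𝔓 →+* k') (hφ : Function.Injective φ)
    {σ : absoluteGaloisGroup K} (hσ : IsArithFrobAt (𝓞 K) σ 𝔓) (A' : AddSubgroup A)
    (hA'σ : ∀ P : A, P ∈ A' → σ • P ∈ A')
    {c : ℕ} (hcA' : ∀ P : A, (∀ τ ∈ 𝔓.inertia (absoluteGaloisGroup K), τ • P = P) → c • P ∈ A')
    (r : A' →+ Additive k'ˣ)
    (hr : ∀ (P : A') (x : absIntegers (𝓞 K) K), φ (Ideal.Quotient.mk 𝔓 x) = ((r P).toMul : k') →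
      ((r ⟨σ • (P : A), hA'σ P P.2⟩).toMul : k') = φ (Ideal.Quotient.mk 𝔓 (σ • x)))
    (hker : ∀ P : A', r P = 0 → ℓ • P = 0 → P = 0)
    (n : ℕ) (P : A) (hP : ∀ τ ∈ 𝔓.inertia (absoluteGaloisGroup K), τ • P = P)
    (hPn : ℓ ^ n • P = 0) :
    σ • (c • P) = v.residueCard • (c • P) := by
  haveI : 𝔓.IsPrime := h𝔓.1
  have hℓ : (ℓ : absIntegers (𝓞 K) K) ∉ 𝔓 := absIntegers.natCast_notMem_of_mem_primesAbove hℓv h𝔓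
  set q := v.residueCard
  set Q : A' := ⟨c • P, hcA' P hP⟩
  have hQn : ℓ ^ n • Q = 0 := Subtype.ext (by
    change ℓ ^ n • (c • P) = 0
    rw [smul_comm, hPn, smul_zero])
  have hQA : ℓ ^ n • (Q : A) = 0 := by simpa using congrArg Subtype.val hQn
  set u : k'ˣ := (r Q).toMul with hu
  have hun : (u : k') ^ ℓ ^ n = 1 := by
    have h := congrArg Additive.toMul (map_nsmul r (ℓ ^ n) Q)
    rw [hQn, map_zero, toMul_zero, toMul_nsmul] at h
    rw [← Units.val_pow_eq_pow_val, ← h, Units.val_one]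
  obtain ⟨μ, -, hμu⟩ := exists_pow_eq_one_map_mk_eq ℓ hℓ φ hφ n hun
  have hfrob : Ideal.Quotient.mk 𝔓 (σ • μ) = Ideal.Quotient.mk 𝔓 μ ^ q := by
    have h := hσ.mk_apply μ
    rw [MulSemiringAction.toAlgHom_apply,
      HeightOneSpectrum.card_quotient_under_eq_residueCard h𝔓] at h
    exact h
  -- `r (σ Q) = u ^ q = r (q • Q)`
  have hσQ : r ⟨σ • (Q : A), hA'σ Q Q.2⟩ = r (q • Q) := by
    apply Additive.toMul.injective
    apply Units.ext
    rw [hr Q μ hμu, hfrob, map_pow, hμu, map_nsmul, toMul_nsmul, Units.val_pow_eq_pow_val]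
  have hP' : ℓ ^ n • (⟨σ • (Q : A), hA'σ Q Q.2⟩ : A') = 0 :=
    Subtype.ext (by simp [smul_comm (ℓ ^ n) σ (Q : A), hQA])
  have hQ' : ℓ ^ n • (q • Q) = 0 := by rw [smul_comm, hQn, smul_zero]
  have key : (⟨σ • (Q : A), hA'σ Q Q.2⟩ : A') = q • Q :=
    eq_of_map_eq_of_pow_smul_eq_zero (A' := A') (B := Additive k'ˣ) r hker hσQ hP' hQ'
  simpa using congrArg Subtype.val key

end Reduction

end Literature.NumberTheory.EllipticCurves

end
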